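import Mathlib
import Summits.Ventures.PercRepro2.Defs
import Summits.Ventures.PercRepro2.Independence
import Summits.Ventures.PercRepro2.Harris
import Summits.Ventures.PercRepro2.Graph
import Summits.Ventures.PercRepro2.Exploration
import Summits.Ventures.PercRepro2.Events
import Summits.Ventures.PercRepro2.FourFunctions
import Summits.Ventures.PercRepro2.Induced
import Summits.Ventures.PercRepro2.Frontier
import Summits.Ventures.PercRepro2.ObsIndependence
import Summits.Ventures.PercRepro2.BHK
import Summits.Ventures.PercRepro2.BHKEvents
import Summits.Ventures.PercRepro2.OrderPreservation
import Summits.Ventures.PercRepro2.BHKAvoid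
import Summits.Ventures.PercRepro2.SameClusterAvoid
import Summits.Ventures.PercRepro2.CaseOneRegime
import Summits.Ventures.PercRepro2.CaseOnePos
import Summits.Ventures.PercRepro2.CaseOneJ11
import Summits.Ventures.PercRepro2.CaseOneRV
import Summits.Ventures.PercRepro2.CaseOnePendant
import Summits.Ventures.PercRepro2.CaseOnePendantAny
import Summits.Ventures.PercRepro2.CaseOnePendantNec
import Summits.Ventures.PercRepro2.CaseOneDWorld
import Summits.Ventures.PercRepro2.CaseOneDWorldPin
import Summits.Ventures.PercRepro2.HullDefs
import Summits.Ventures.PercRepro2.OneEdge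
import Summits.Ventures.PercRepro2.StarPattern
import Summits.Ventures.PercRepro2.HCov
import Summits.Ventures.PercRepro2.HCovSwap
import Summits.Ventures.PercRepro2.OddsLemma
import Summits.Ventures.PercRepro2.RV
import Summits.Ventures.PercRepro2.RVBridge
import Summits.Ventures.PercRepro2.CaseOneDWorldOdds
import Summits.Ventures.PercRepro2.CaseOneTwoMark
import Summits.Ventures.PercRepro2.CaseOneTwoMarkMass

/-!
# `a₃` adjacent exactly to `o` and `b`: the BHK atoms of the base and the Bernstein coefficients
(blind cell PercRepro2, p1 g14; S5 §2.1 (K9) (j)–(k), proofs/P1-DWORLD.md §4e)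

For an arbitrary weight vector `p` and the base events `Q₀ = {a₁ ↮ a₂}`, `O₁ = {a₁ ↔ o}`,
`O₂ = {a₂ ↔ o}`, `B₁ = {a₁ ↔ b}`, `B₂ = {a₂ ↔ b}`: the degree-2 inequalities used by the exact LP
certificates of the `(3,3)`-Bernstein coefficients of the Q-world `(ii)` for `a₃ ~ {o, b}` —
BHK 1.3 on `C₂` (`tm_bhk_same_a2`), BHK 1.4 in both orders (`tm_bhk_cross_o1_b2`,
`tm_bhk_cross_b1_o2`), BHK 1.4 with `C₁` avoiding `{a₂, o}` (`tm_bhk_avoid_c1`), the Q-pair odds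
condition at `b` (`tm_oddsQ_b`) and the odds lemma at `b` (`tm_odds_b`). The coefficients they
certify are in `CaseOneTwoMarkII.lean`. -/

namespace Summit.Ventures.PercRepro2

namespace CaseOne

section Atoms
variable {V : Type*} {E : Type*} [Fintype E] [DecidableEq E] [Fintype V] [DecidableEq V]
  {R : Type*} [Field R] [LinearOrder R] [IsStrictOrderedRing R]

/-- **BHK 1.3 on `C₂` under `Q₀`** (atom H13C2): `P(Q₀, B₂) · P(Q₀, O₂) ≤ P(Q₀, O₂, B₂) · P(Q₀)`. -/
lemma tm_bhk_same_a2 (p : E → R) (hp : IsProbVec p) (ends : E → Sym2 V) (o a₁ a₂ b : V) :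
    prob p ((connEvent ends a₁ a₂)ᶜ ∩ connEvent ends a₂ b) *
        prob p ((connEvent ends a₁ a₂)ᶜ ∩ connEvent ends a₂ o) ≤
      prob p ((connEvent ends a₁ a₂)ᶜ ∩ connEvent ends a₂ o ∩ connEvent ends a₂ b) *
        prob p (connEvent ends a₁ a₂)ᶜ := by
  have h := bhk_same_cluster_events p hp ends a₂ a₁ (isUpperSet_mem_setOf b) (isUpperSet_mem_setOf o)
  rw [← connEvent_eq_clusterInEvent, ← connEvent_eq_clusterInEvent, connEvent_comm ends a₂ a₁] at h
  have e1 : connEvent ends a₂ b ∩ (connEvent ends a₁ a₂)ᶜ =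
      (connEvent ends a₁ a₂)ᶜ ∩ connEvent ends a₂ b := Set.inter_comm _ _
  have e2 : connEvent ends a₂ o ∩ (connEvent ends a₁ a₂)ᶜ =
      (connEvent ends a₁ a₂)ᶜ ∩ connEvent ends a₂ o := Set.inter_comm _ _
  have e3 : connEvent ends a₂ b ∩ connEvent ends a₂ o ∩ (connEvent ends a₁ a₂)ᶜ =
      (connEvent ends a₁ a₂)ᶜ ∩ connEvent ends a₂ o ∩ connEvent ends a₂ b := by
    ext ω
    simp only [Set.mem_inter_iff, Set.mem_compl_iff]
    tauto
  rw [prob_congr_set p e1, prob_congr_set p e2, prob_congr_set p e3] at h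
  exact h

/-- **BHK 1.4 under `Q₀`, `o ∈ C₁` against `b ∈ C₂`** (atom H14bo):
`P(Q₀) · P(Q₀, O₁, B₂) ≤ P(Q₀, B₂) · P(Q₀, O₁)`. -/
lemma tm_bhk_cross_o1_b2 (p : E → R) (hp : IsProbVec p) (ends : E → Sym2 V) (o a₁ a₂ b : V) :
    prob p (connEvent ends a₁ a₂)ᶜ *
        prob p ((connEvent ends a₁ a₂)ᶜ ∩ connEvent ends a₁ o ∩ connEvent ends a₂ b) ≤
      prob p ((connEvent ends a₁ a₂)ᶜ ∩ connEvent ends a₂ b) *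
        prob p ((connEvent ends a₁ a₂)ᶜ ∩ connEvent ends a₁ o) := by
  have h := bhk_cross_cluster p hp ends a₁ a₂ (isUpperSet_mem_setOf o) (isUpperSet_mem_setOf b)
  rw [← connEvent_eq_clusterInEvent, ← connEvent_eq_clusterInEvent] at h
  have e1 : connEvent ends a₁ o ∩ connEvent ends a₂ b ∩ (connEvent ends a₁ a₂)ᶜ =
      (connEvent ends a₁ a₂)ᶜ ∩ connEvent ends a₁ o ∩ connEvent ends a₂ b := by
    ext ω
    simp only [Set.mem_inter_iff, Set.mem_compl_iff]
    tauto
  have e2 : connEvent ends a₁ o ∩ (connEvent ends a₁ a₂)ᶜ =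
      (connEvent ends a₁ a₂)ᶜ ∩ connEvent ends a₁ o := Set.inter_comm _ _
  have e3 : connEvent ends a₂ b ∩ (connEvent ends a₁ a₂)ᶜ =
      (connEvent ends a₁ a₂)ᶜ ∩ connEvent ends a₂ b := Set.inter_comm _ _
  rw [prob_congr_set p e1, prob_congr_set p e2, prob_congr_set p e3] at h
  linarith [h]

/-- **BHK 1.4 under `Q₀`, `b ∈ C₁` against `o ∈ C₂`** (atom H14ob):
`P(Q₀) · P(Q₀, B₁, O₂) ≤ P(Q₀, O₂) · P(Q₀, B₁)`. -/
lemma tm_bhk_cross_b1_o2 (p : E → R) (hp : IsProbVec p) (ends : E → Sym2 V) (o a₁ a₂ b : V) :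
    prob p (connEvent ends a₁ a₂)ᶜ *
        prob p ((connEvent ends a₁ a₂)ᶜ ∩ connEvent ends a₁ b ∩ connEvent ends a₂ o) ≤
      prob p ((connEvent ends a₁ a₂)ᶜ ∩ connEvent ends a₂ o) *
        prob p ((connEvent ends a₁ a₂)ᶜ ∩ connEvent ends a₁ b) := by
  have h := bhk_cross_cluster p hp ends a₁ a₂ (isUpperSet_mem_setOf b) (isUpperSet_mem_setOf o)
  rw [← connEvent_eq_clusterInEvent, ← connEvent_eq_clusterInEvent] at h
  have e1 : connEvent ends a₁ b ∩ connEvent ends a₂ o ∩ (connEvent ends a₁ a₂)ᶜ =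
      (connEvent ends a₁ a₂)ᶜ ∩ connEvent ends a₁ b ∩ connEvent ends a₂ o := by
    ext ω
    simp only [Set.mem_inter_iff, Set.mem_compl_iff]
    tauto
  have e2 : connEvent ends a₁ b ∩ (connEvent ends a₁ a₂)ᶜ =
      (connEvent ends a₁ a₂)ᶜ ∩ connEvent ends a₁ b := Set.inter_comm _ _
  have e3 : connEvent ends a₂ o ∩ (connEvent ends a₁ a₂)ᶜ =
      (connEvent ends a₁ a₂)ᶜ ∩ connEvent ends a₂ o := Set.inter_comm _ _
  rw [prob_congr_set p e1, prob_congr_set p e2, prob_congr_set p e3] at h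
  linarith [h]

/-- **BHK 1.4 with `C₁` avoiding `{a₂, o}`, `b ∈ C₁` against `o ∈ C₂`** (atom H14mav_o):
`P(Q₀, B₁, O₂) · (P(Q₀) − P(Q₀, O₁)) ≤ (P(Q₀, B₁) − P(Q₀, O₁, B₁)) · P(Q₀, O₂)`. -/
lemma tm_bhk_avoid_c1 (p : E → R) (hp : IsProbVec p) (ends : E → Sym2 V) (o a₁ a₂ b : V) :
    prob p ((connEvent ends a₁ a₂)ᶜ ∩ connEvent ends a₁ b ∩ connEvent ends a₂ o) *
        (prob p (connEvent ends a₁ a₂)ᶜ - prob p ((connEvent ends a₁ a₂)ᶜ ∩ connEvent ends a₁ o)) ≤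
      (prob p ((connEvent ends a₁ a₂)ᶜ ∩ connEvent ends a₁ b) -
          prob p ((connEvent ends a₁ a₂)ᶜ ∩ connEvent ends a₁ o ∩ connEvent ends a₁ b)) *
        prob p ((connEvent ends a₁ a₂)ᶜ ∩ connEvent ends a₂ o) := by
  have h := bhk_cross_cluster_avoid p hp ends a₁ a₂ (X := {a₂, o}) (by simp)
    (isUpperSet_mem_setOf b) (isUpperSet_mem_setOf o)
  rw [← connEvent_eq_clusterInEvent, ← connEvent_eq_clusterInEvent] at h
  have hav : avoidAll ends a₁ {a₂, o} = (connEvent ends a₁ a₂)ᶜ ∩ (connEvent ends a₁ o)ᶜ := by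
    ext ω
    simp only [mem_avoidAll, Finset.mem_insert, Finset.mem_singleton, Set.mem_inter_iff,
      Set.mem_compl_iff, mem_connEvent]
    constructor
    · intro hh
      exact ⟨hh a₂ (Or.inl rfl), hh o (Or.inr rfl)⟩
    · rintro ⟨h1, h2⟩ x hx
      rcases hx with rfl | rfl
      · exact h1
      · exact h2
  rw [hav] at h
  have e1 : connEvent ends a₁ b ∩ connEvent ends a₂ o ∩ ((connEvent ends a₁ a₂)ᶜ ∩ (connEvent ends a₁ o)ᶜ) =
      (connEvent ends a₁ a₂)ᶜ ∩ connEvent ends a₁ b ∩ connEvent ends a₂ o := by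
    ext ω
    simp only [Set.mem_inter_iff, Set.mem_compl_iff, mem_connEvent]
    have t1 : Conn ends ω a₁ o → Conn ends ω a₂ o → Conn ends ω a₁ a₂ :=
      fun x y => conn_trans x (conn_symm y)
    tauto
  have e2 : connEvent ends a₂ o ∩ ((connEvent ends a₁ a₂)ᶜ ∩ (connEvent ends a₁ o)ᶜ) =
      (connEvent ends a₁ a₂)ᶜ ∩ connEvent ends a₂ o := by
    ext ω
    simp only [Set.mem_inter_iff, Set.mem_compl_iff, mem_connEvent]
    have t1 : Conn ends ω a₁ o → Conn ends ω a₂ o → Conn ends ω a₁ a₂ :=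
      fun x y => conn_trans x (conn_symm y)
    tauto
  have s1 := prob_inter_add_prob_inter_compl p (connEvent ends a₁ a₂)ᶜ (connEvent ends a₁ o)
  have s2 := prob_inter_add_prob_inter_compl p ((connEvent ends a₁ a₂)ᶜ ∩ connEvent ends a₁ b)
    (connEvent ends a₁ o)
  have e3 : connEvent ends a₁ b ∩ ((connEvent ends a₁ a₂)ᶜ ∩ (connEvent ends a₁ o)ᶜ) =
      (connEvent ends a₁ a₂)ᶜ ∩ connEvent ends a₁ b ∩ (connEvent ends a₁ o)ᶜ := by
    ext ω
    simp only [Set.mem_inter_iff, Set.mem_compl_iff]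
    tauto
  have e4 : (connEvent ends a₁ a₂)ᶜ ∩ connEvent ends a₁ b ∩ connEvent ends a₁ o =
      (connEvent ends a₁ a₂)ᶜ ∩ connEvent ends a₁ o ∩ connEvent ends a₁ b := Set.inter_right_comm _ _ _
  rw [prob_congr_set p e1, prob_congr_set p e2, prob_congr_set p e3] at h
  rw [e4] at s2
  have hY : prob p ((connEvent ends a₁ a₂)ᶜ ∩ (connEvent ends a₁ o)ᶜ) =
      prob p (connEvent ends a₁ a₂)ᶜ - prob p ((connEvent ends a₁ a₂)ᶜ ∩ connEvent ends a₁ o) := by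
    linarith [s1]
  have hZ : prob p ((connEvent ends a₁ a₂)ᶜ ∩ connEvent ends a₁ b ∩ (connEvent ends a₁ o)ᶜ) =
      prob p ((connEvent ends a₁ a₂)ᶜ ∩ connEvent ends a₁ b) -
        prob p ((connEvent ends a₁ a₂)ᶜ ∩ connEvent ends a₁ o ∩ connEvent ends a₁ b) := by
    linarith [s2]
  rw [hY, hZ] at h
  exact h

/-- **The Q-pair odds condition at `b`** (atom oddsQ_b, `odds_q`):
`P(Q₀) · P(Q₀, B₁, O₂) ≤ P(Q₀, B₁) · P(Q₀, o ∈ U)`. -/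
lemma tm_oddsQ_b (p : E → R) (hp : IsProbVec p) (ends : E → Sym2 V) (o a₁ a₂ b : V) :
    prob p (connEvent ends a₁ a₂)ᶜ *
        prob p ((connEvent ends a₁ a₂)ᶜ ∩ connEvent ends a₁ b ∩ connEvent ends a₂ o) ≤
      prob p ((connEvent ends a₁ a₂)ᶜ ∩ connEvent ends a₁ b) *
        prob p ((connEvent ends a₁ a₂)ᶜ ∩ (connEvent ends a₁ o ∪ connEvent ends a₂ o)) := by
  have h := odds_q p hp ends o a₁ a₂ b
  unfold Dqo at h
  have e1 : connEvent ends a₁ b ∩ connEvent ends a₂ o ∩ (connEvent ends a₁ a₂)ᶜ =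
      (connEvent ends a₁ a₂)ᶜ ∩ connEvent ends a₁ b ∩ connEvent ends a₂ o := by
    ext ω
    simp only [Set.mem_inter_iff, Set.mem_compl_iff]
    tauto
  have e2 : connEvent ends a₁ b ∩ (connEvent ends a₁ a₂)ᶜ =
      (connEvent ends a₁ a₂)ᶜ ∩ connEvent ends a₁ b := Set.inter_comm _ _
  have e3 : (connEvent ends a₁ o ∪ connEvent ends a₂ o) ∩ (connEvent ends a₁ a₂)ᶜ =
      (connEvent ends a₁ a₂)ᶜ ∩ (connEvent ends a₁ o ∪ connEvent ends a₂ o) := Set.inter_comm _ _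
  rw [prob_congr_set p e1, prob_congr_set p e2, prob_congr_set p e3] at h
  linarith [h]

/-- **The odds lemma at `b`** (atom odds_b, `odds_pd` with `a₃ := b`):
`(P(Q₀) − P(Q₀, b ∈ U)) · P(Q₀, B₁, O₂) ≤ (P(Q₀, o ∈ U) − P(Q₀, o ∈ U, b ∈ U)) · P(Q₀, B₁)`. -/
lemma tm_odds_b (p : E → R) (hp : IsProbVec p) (ends : E → Sym2 V) (o a₁ a₂ b : V) :
    (prob p (connEvent ends a₁ a₂)ᶜ -
          prob p ((connEvent ends a₁ a₂)ᶜ ∩ (connEvent ends a₁ b ∪ connEvent ends a₂ b))) *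
        prob p ((connEvent ends a₁ a₂)ᶜ ∩ connEvent ends a₁ b ∩ connEvent ends a₂ o) ≤
      (prob p ((connEvent ends a₁ a₂)ᶜ ∩ (connEvent ends a₁ o ∪ connEvent ends a₂ o)) -
          prob p ((connEvent ends a₁ a₂)ᶜ ∩ (connEvent ends a₁ o ∪ connEvent ends a₂ o) ∩
            (connEvent ends a₁ b ∪ connEvent ends a₂ b))) *
        prob p ((connEvent ends a₁ a₂)ᶜ ∩ connEvent ends a₁ b) := by
  have h := odds_pd p hp ends o a₁ a₂ b
  unfold Dpd Dpdo at h
  have e1 : connEvent ends a₁ b ∩ connEvent ends a₂ o ∩ (connEvent ends a₁ a₂)ᶜ =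
      (connEvent ends a₁ a₂)ᶜ ∩ connEvent ends a₁ b ∩ connEvent ends a₂ o := by
    ext ω
    simp only [Set.mem_inter_iff, Set.mem_compl_iff]
    tauto
  have e2 : connEvent ends a₁ b ∩ (connEvent ends a₁ a₂)ᶜ =
      (connEvent ends a₁ a₂)ᶜ ∩ connEvent ends a₁ b := Set.inter_comm _ _
  have e3 : (connEvent ends a₁ b)ᶜ ∩ (connEvent ends a₂ b)ᶜ ∩ (connEvent ends a₁ a₂)ᶜ =
      (connEvent ends a₁ a₂)ᶜ ∩ (connEvent ends a₁ b ∪ connEvent ends a₂ b)ᶜ := by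
    ext ω
    simp only [Set.mem_inter_iff, Set.mem_compl_iff, Set.mem_union]
    tauto
  have e4 : (connEvent ends a₁ o ∪ connEvent ends a₂ o) ∩ (connEvent ends a₁ b)ᶜ ∩
      (connEvent ends a₂ b)ᶜ ∩ (connEvent ends a₁ a₂)ᶜ =
      (connEvent ends a₁ a₂)ᶜ ∩ (connEvent ends a₁ o ∪ connEvent ends a₂ o) ∩
        (connEvent ends a₁ b ∪ connEvent ends a₂ b)ᶜ := by
    ext ω
    simp only [Set.mem_inter_iff, Set.mem_compl_iff, Set.mem_union]
    tauto
  rw [prob_congr_set p e1, prob_congr_set p e2, prob_congr_set p e3, prob_congr_set p e4] at h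
  have s1 := prob_inter_add_prob_inter_compl p (connEvent ends a₁ a₂)ᶜ
    (connEvent ends a₁ b ∪ connEvent ends a₂ b)
  have s2 := prob_inter_add_prob_inter_compl p
    ((connEvent ends a₁ a₂)ᶜ ∩ (connEvent ends a₁ o ∪ connEvent ends a₂ o))
    (connEvent ends a₁ b ∪ connEvent ends a₂ b)
  have hY : prob p ((connEvent ends a₁ a₂)ᶜ ∩ (connEvent ends a₁ b ∪ connEvent ends a₂ b)ᶜ) =
      prob p (connEvent ends a₁ a₂)ᶜ -
        prob p ((connEvent ends a₁ a₂)ᶜ ∩ (connEvent ends a₁ b ∪ connEvent ends a₂ b)) := by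
    linarith [s1]
  have hZ : prob p ((connEvent ends a₁ a₂)ᶜ ∩ (connEvent ends a₁ o ∪ connEvent ends a₂ o) ∩
      (connEvent ends a₁ b ∪ connEvent ends a₂ b)ᶜ) =
      prob p ((connEvent ends a₁ a₂)ᶜ ∩ (connEvent ends a₁ o ∪ connEvent ends a₂ o)) -
        prob p ((connEvent ends a₁ a₂)ᶜ ∩ (connEvent ends a₁ o ∪ connEvent ends a₂ o) ∩
          (connEvent ends a₁ b ∪ connEvent ends a₂ b)) := by
    linarith [s2]
  rw [hY, hZ] at h
  exact h

end Atoms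

end CaseOne

end Summit.Ventures.PercRepro2
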